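import Mathlib
import Summits.ValiantsHypothesis.ValiantsHypothesis.Theorems.GrenetZeonTwoDimCoefficientsDefs
import Summits.ValiantsHypothesis.ValiantsHypothesis.Theorems.GrenetZeonTwoDimCoefficientsDualUnipotentCentredCrossForm

/-!
# Crux `GrenetZeon.TwoDimCoefficients` (stmt-ValiantsHypothesis-8062) / rung `DualUnipotentThreeHalves` (stmt-24318):
# the top trace of a CONSECUTIVE-LEVEL GRADED pencil — level bookkeeping and its exact Hessian at every point

Memo TWENTY-SECOND HAND (evidence on both items), Theorem T7 and kernel plan §4 step 1.  A pencil `N` is CONSECUTIVE-LEVEL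
GRADED for a level function `lvl : Fin m → ℕ` when `N a b ≠ 0 ⇒ lvl b = lvl a + 1`.  Then the powers are graded
(`(N^k) a b ≠ 0 ⇒ lvl b = lvl a + k`), the top trace `tr(N^k·M)` only sees the `k`-drop positions of `M`
(`M^{(k)} i j := [lvl i = lvl j + k]·M i j`), `tr(N^j·M^{(k)}) = 0` for `j ≠ k`, and `N` is nilpotent.  Consequently the
RESOLVENT trace of `(N, M^{(n−1)})` IS the top trace `tr(N^{n−1}·M)`, and the tree's exact formula
✓ `hess0_transl_resolvent_eq_cross` (`Hess_p = Ψ + Ψᵀ`, `Ψ(s,t) = tr(K·N_s·K·(M_t + N_t·K·M(p)))`, `K = Σ_{j<m} N(p)^j`) gives the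
Hessian of the graded top trace at EVERY point in closed form — the entry point of the coordinated-pivot slot accounting (T7) in
pencil currency, with no new polynomial calculus:

* `pow_apply_eq_zero_of_graded` — powers of a consecutive-graded pencil are graded;
* `trace_pow_mul_eq_trace_pow_mul_dropPart` — `tr(N^k·M) = tr(N^k·M^{(k)})`;
* `trace_pow_mul_dropPart_eq_zero` — `tr(N^j·M^{(k)}) = 0` for `j ≠ k`;
* `sum_trace_pow_mul_dropPart_eq` — `Σ_{j<m} tr(N^j·M^{(k)}) = tr(N^k·M)` (`k < m`);
* `pow_eq_zero_of_graded` — `N^m = 0`;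
* ★ `hess0_transl_trace_pow_mul_eq_cross_of_graded` — the exact Hessian of `tr(N^{n−1}·M)` at every point for affine
  consecutive-graded `N` and affine `M`.

Pure bookkeeping.  HONEST FRAMING: a brick (step 1 of 5 of the memo's kernel plan for the graded class); the stub
`DualUnipotentBound`, the 24318 decl, `stub_longMassSlowLawInv` and `VP ≠ VNP` remain open.

References: folklore linear algebra.
-/

-- single-conjunct layout `Summits/ValiantsHypothesis/ValiantsHypothesis`: the duplicated namespace
-- component is mandated by the tree.
set_option linter.dupNamespace false
set_option autoImplicit false

noncomputable section

namespace Summit.ValiantsHypothesis.ValiantsHypothesis.Theorems.GrenetZeonTwoDimCoefficients.GradedTopTrace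

open MvPolynomial Matrix
open Literature.Computability.AlgebraicComplexity
open Summit.ValiantsHypothesis.ValiantsHypothesis.Cruxes.TwoDimCoefficients.DimTwoCases (AffMat IsAffine)
open Summit.ValiantsHypothesis.ValiantsHypothesis.Theorems.GrenetZeon.CentredNumerator
  (hess0_transl_resolvent_eq_cross)

/-! ### Level bookkeeping for consecutive-graded pencils (any commutative ring) -/

section Graded

variable {R : Type*} [CommRing R] {m : ℕ} (lvl : Fin m → ℕ)

/-- Powers of a consecutive-level graded pencil are graded: `(N^k) a b ≠ 0 ⇒ lvl b = lvl a + k`. [folklore] -/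
theorem pow_apply_eq_zero_of_graded (N : Matrix (Fin m) (Fin m) R)
    (hN : ∀ a b, lvl b ≠ lvl a + 1 → N a b = 0) :
    ∀ (k : ℕ) (a b : Fin m), lvl b ≠ lvl a + k → (N ^ k) a b = 0
  | 0, a, b, h => by
      rw [pow_zero, Matrix.one_apply, if_neg]
      rintro rfl
      exact h (by simp)
  | k + 1, a, b, h => by
      rw [pow_succ, Matrix.mul_apply]
      refine Finset.sum_eq_zero fun c _ => ?_
      by_cases hc : lvl c = lvl a + k
      · rw [hN c b (by omega), mul_zero]
      · rw [pow_apply_eq_zero_of_graded N hN k a c hc, zero_mul]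

/-- `tr(N^k·M)` only sees the `k`-drop positions of `M`: `tr(N^k·M) = tr(N^k·M^{(k)})` with
`M^{(k)} i j = [lvl i = lvl j + k]·M i j`. [folklore] -/
theorem trace_pow_mul_eq_trace_pow_mul_dropPart (N M : Matrix (Fin m) (Fin m) R)
    (hN : ∀ a b, lvl b ≠ lvl a + 1 → N a b = 0) (k : ℕ) :
    (N ^ k * M).trace = (N ^ k * Matrix.of (fun i j => if lvl i = lvl j + k then M i j else 0)).trace := by
  simp only [Matrix.trace, Matrix.diag, Matrix.mul_apply, Matrix.of_apply]
  refine Finset.sum_congr rfl fun a _ => Finset.sum_congr rfl fun c _ => ?_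
  by_cases hc : lvl c = lvl a + k
  · rw [if_pos hc]
  · rw [pow_apply_eq_zero_of_graded lvl N hN k a c hc, zero_mul, zero_mul]

/-- Off-degree powers do not see the `k`-drop part: `tr(N^j·M^{(k)}) = 0` for `j ≠ k`. [folklore] -/
theorem trace_pow_mul_dropPart_eq_zero (N M : Matrix (Fin m) (Fin m) R)
    (hN : ∀ a b, lvl b ≠ lvl a + 1 → N a b = 0) {j k : ℕ} (hjk : j ≠ k) :
    (N ^ j * Matrix.of (fun i j' => if lvl i = lvl j' + k then M i j' else 0)).trace = 0 := by
  simp only [Matrix.trace, Matrix.diag, Matrix.mul_apply, Matrix.of_apply]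
  refine Finset.sum_eq_zero fun a _ => Finset.sum_eq_zero fun c _ => ?_
  by_cases hc : lvl c = lvl a + j
  · rw [if_neg (by omega), mul_zero]
  · rw [pow_apply_eq_zero_of_graded lvl N hN j a c hc, zero_mul]

/-- The resolvent trace against the `k`-drop part is the top trace: `Σ_{j<m} tr(N^j·M^{(k)}) = tr(N^k·M)` (`k < m`).
[folklore] -/
theorem sum_trace_pow_mul_dropPart_eq (N M : Matrix (Fin m) (Fin m) R)
    (hN : ∀ a b, lvl b ≠ lvl a + 1 → N a b = 0) {k : ℕ} (hk : k < m) :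
    ∑ j ∈ Finset.range m, (N ^ j * Matrix.of (fun i j' => if lvl i = lvl j' + k then M i j' else 0)).trace =
      (N ^ k * M).trace := by
  rw [Finset.sum_eq_single k, ← trace_pow_mul_eq_trace_pow_mul_dropPart lvl N M hN k]
  · intro j _ hj
    exact trace_pow_mul_dropPart_eq_zero lvl N M hN hj
  · intro h
    exact absurd (Finset.mem_range.mpr hk) h

/-- A consecutive-level graded pencil is nilpotent of index `≤ (max level) + 1`: `N^(h+1) = 0` whenever `lvl ≤ h`.
[folklore] -/
theorem pow_succ_eq_zero_of_graded_of_lvl_le (N : Matrix (Fin m) (Fin m) R)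
    (hN : ∀ a b, lvl b ≠ lvl a + 1 → N a b = 0) (h : ℕ) (hh : ∀ i, lvl i ≤ h) : N ^ (h + 1) = 0 := by
  ext a b
  rw [Matrix.zero_apply]
  refine pow_apply_eq_zero_of_graded lvl N hN (h + 1) a b ?_
  have := hh b
  omega

end Graded

/-! ### Nilpotency at the size and the exact Hessian (over `ℂ`) -/

section Complex

variable {n m : ℕ} (lvl : Fin m → ℕ)

/-- Over a domain a consecutive-level graded `m × m` pencil satisfies `N^m = 0` (some power vanishes by grading;
Cayley–Hamilton brings the exponent down to `m`). [folklore] -/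
theorem pow_eq_zero_of_graded (N : AffMat n m) (hN : ∀ a b, lvl b ≠ lvl a + 1 → N a b = 0) : N ^ m = 0 := by
  classical
  -- some power vanishes
  set h : ℕ := Finset.univ.sup lvl with hh
  have hle : ∀ i, lvl i ≤ h := fun i => Finset.le_sup (f := lvl) (Finset.mem_univ i)
  have hpow : N ^ (h + 1) = 0 := pow_succ_eq_zero_of_graded_of_lvl_le lvl N hN h hle
  -- Cayley–Hamilton
  have hnil : IsNilpotent (N.charpoly - Polynomial.X ^ m) := by
    simpa [Fintype.card_fin] using Matrix.isNilpotent_charpoly_sub_pow_of_isNilpotent ⟨h + 1, hpow⟩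
  have hchar : N.charpoly = Polynomial.X ^ m := sub_eq_zero.1 hnil.eq_zero
  have hCH := Matrix.aeval_self_charpoly N
  rwa [hchar, map_pow, Polynomial.aeval_X] at hCH

/-- The `k`-drop part of an affine matrix is affine. [folklore] -/
theorem isAffine_dropPart (M : AffMat n m) (hM : IsAffine M) (k : ℕ) :
    IsAffine (Matrix.of (fun i j => if lvl i = lvl j + k then M i j else 0) : AffMat n m) := by
  intro i j
  rw [Matrix.of_apply]
  split_ifs
  · exact hM i j
  · rw [totalDegree_zero]; exact Nat.zero_le _

/-- ★ **Exact Hessian of the graded top trace at every point.**  For affine `N`, `M` with `N` consecutive-level graded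
for `lvl` and `n − 1 < m`, at every point `p`:
`Hess_p tr(N^{n−1}·M) = Ψ + Ψᵀ`, `Ψ(s,t) = tr(K·N_s·K·(M'_t + N_t·K·M'(p)))`, `K = Σ_{j<m} N(p)^j`, `M' = M^{(n−1)}` the
`(n−1)`-drop part of `M` — the tree's resolvent cross formula applied to `(N, M^{(n−1)})`. [folklore] -/
theorem hess0_transl_trace_pow_mul_eq_cross_of_graded (N M : AffMat n m) (hN : IsAffine N) (hM : IsAffine M)
    (hgr : ∀ a b, lvl b ≠ lvl a + 1 → N a b = 0) (hnm : n - 1 < m) (p : Fin n × Fin n → ℂ) :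
    hess0 (transl p ((N ^ (n - 1) * M).trace)) =
      (Matrix.of fun s t : Fin n × Fin n =>
        ((∑ j ∈ Finset.range m, N.map (eval p) ^ j) * N.map (coeff (Finsupp.single s 1)) *
          (∑ j ∈ Finset.range m, N.map (eval p) ^ j) *
          ((Matrix.of (fun i j => if lvl i = lvl j + (n - 1) then M i j else 0) : AffMat n m).map
              (coeff (Finsupp.single t 1)) +
            N.map (coeff (Finsupp.single t 1)) * ((∑ j ∈ Finset.range m, N.map (eval p) ^ j) *
              ((Matrix.of (fun i j => if lvl i = lvl j + (n - 1) then M i j else 0) : AffMat n m).map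
                (eval p))))).trace) +
      (Matrix.of fun s t : Fin n × Fin n =>
        ((∑ j ∈ Finset.range m, N.map (eval p) ^ j) * N.map (coeff (Finsupp.single s 1)) *
          (∑ j ∈ Finset.range m, N.map (eval p) ^ j) *
          ((Matrix.of (fun i j => if lvl i = lvl j + (n - 1) then M i j else 0) : AffMat n m).map
              (coeff (Finsupp.single t 1)) +
            N.map (coeff (Finsupp.single t 1)) * ((∑ j ∈ Finset.range m, N.map (eval p) ^ j) *
              ((Matrix.of (fun i j => if lvl i = lvl j + (n - 1) then M i j else 0) : AffMat n m).map
                (eval p))))).trace)ᵀ := by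
  rw [← sum_trace_pow_mul_dropPart_eq lvl N M hgr hnm]
  exact hess0_transl_resolvent_eq_cross N _ hN (isAffine_dropPart lvl M hM (n - 1))
    (pow_eq_zero_of_graded lvl N hgr) p

end Complex

end Summit.ValiantsHypothesis.ValiantsHypothesis.Theorems.GrenetZeonTwoDimCoefficients.GradedTopTrace

end
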